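import Literature.MathematicalPhysics.QuantumFieldTheory.Balaban1983to89.B11Eq81Expansion
import Literature.MathematicalPhysics.QuantumFieldTheory.Balaban1983to89.B11Eq108Reduction
import Literature.MathematicalPhysics.QuantumFieldTheory.Balaban1983to89.B11

/-!
# `Balaban1983to89.B11Prop5Model` — T. Bałaban, *The variational problem and background fields in renormalization group method
# for lattice gauge theories*, Commun. Math. Phys. **102** (1985) 277–309 [Balaban1985Variational], **Proposition 5** (p. 294):
# §1 the Sect. D chain (82) ⇔ (99)–(100) ⇔ (101)–(102) ⇔ (108)–(109) ⇔ (111) ASSEMBLED into one kernel-checked equivalence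
# («A′ = A₁ + H₁B in the space (75)–(76) is a critical configuration of 𝔉 (82) iff A₁ solves Eq. (111)»), §2 the typed statement of
# record `B11.Prop5Printed B₁ B₃ C₁ fam` INHABITED BY NAME for the linearized-coordinate model family (kind «model-instance»)

statement-level skeleton of published theorems with citation tags; proofs where landed; nothing here is a claim about the Yang–Mills mass gap

PDF held: `paper:balaban1985-cmp102-variational-background` (journal page = PDF page + 276); pp. 289–294 (PDF 13–18) read from the held text
by this seat (2026-08-21); renders of pp. 290, 293 were read as images by gens 2 of this seat (`B11Eq81Expansion`, `B11Eq101Translation`).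

WHAT IS REPRODUCED.  SKELETON row `B11.Prop5` (reader r08 `ROWS-B11.md`; decl of record `B11.Prop5Printed`, B11.lean, typed-existing over
the abstract Landau-gauge carrier `B11.LGData`).  THE PRINTED TEXT (p. 294 [PDF 18], verbatim): *"Let us summarize the results of the
discussion concerning the variational problem. Proposition 5. All critical configurations U₁ of the functional A(U₁U₀) in the space defined
by (19)–(21), U₀ satisfies (14), can be obtained from solutions of Eq. (111) in the space (104) by the transformation U₁ = exp iη[A₁ + H₁B −
HD(A₁ + H₁B)]. (112)"*, and the steps it summarises: p. 290 *"by Proposition 2 it is enough to prove that the functional 𝔉 considered on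
configurations A′ satisfying (75)–(77) has exactly one critical configuration … To find critical points of this functional we have to find
A′ in the considered space, such that the equation ⟨(δ/δA′)𝔉(A′), δA′⟩ = 0 (82) holds for all δA′ in the tangent space, that is δA′
satisfying the conditions QδA′ = 0, RD*δA′ = 0. (83)"*, (84), p. 293 (99)–(104) *"We make the translation A′ = A₁ + H₁B … \[(101), (102)\] …
|H₁B| < B₀2dLC₁ε₁(L^jη)^{−1} …, 2dLB₀C₁ε₁ < B₁C₁ε₁ < ε₃, (103) so A₁ satisfies |A₁| < 2ε₃(L^jη)^{−1}, |∇A₁| < 2ε₃(L^jη)^{−2} on Ω_j.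
(104)"*, pp. 293–294 (105)–(111).

THE PRINTED PROOF, AND WHERE IT IS IN THE TREE.  (74)–(84): `B11Eq81Expansion` (r08 gen 2: `functional74`, `eq81`, (82) `IsCritical82`,
(83) `tangent83`, (84) `hasFDerivAt84`, `isCritical82_iff`); (99)–(102): `B11Eq101Translation` (r08 gen 2: `eq99_iff`, «⟨δA′, Δ₁H₁B⟩ = 0»
`inner_delta1_H1_eq_zero`, `eq101_of_eq99`/`eq99_of_eq101`, `eq102`; H₁B = `B11Eq129Minimizer.hOp`); (105)–(111): `B11Eq108Reduction` (r08
gen 6: `eq111_iff_eq101`, «Q𝔊 = 0, RD*𝔊 = 0» `frakG_mem`).  THIS FILE, §1: the three links composed — **`critical82_iff_eq111`**: for A′ with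
QA′ = b, RD*A′ = 0 ((75)–(76)), A′ is (82)-critical for the derivative (84) `⟨·, J⟩ + ⟨·, Δ₁A′⟩ + ⟨·, W⟩` (W = ((δ/δA′)V)(A′)) on the
tangent space (83) IFF A₁ = A′ − H₁B solves (111) `A₁ + 𝔊J + 𝔊W = 0`, 𝔊 = G₁𝔓*; §2: the model family (`SectDOps`, `SectDOps.Hyps`, `VarDatum`,
`VarDatum.toLGData`) and **`prop5Printed_model : B11.Prop5Printed B₁ B₃ C₁ (fun i => (δ i).toLGData B₁)`**.

MODEL / DECLARED READINGS (each a field of `VarDatum.toLGData`).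
 (M1) LINEARIZED COORDINATES: per index the model's «perturbations U₁» (`Pert`) ARE the Sect. D variables A′ of (74)–(77) — the composite
      of U₁ = exp iηA with Proposition 3's change of variables A = A′ − HD(A′) (47) is NOT constructed (Prop. 3's model is the sibling
      `B11Prop3Model`); accordingly the space (19)–(21) is read through (48) «L^jηQ_jA′ = B» (linear in A′), (76) «RD*(A′ − HD(A′)) = RD*A′ = 0»
      and (62) «A′ with L^jη|A′|, (L^jη)²|∇A′| < 2ε₂» as `In19_21 ε₂ V U₀ A′ := ‖A′‖ < 2ε₂ ∧ QA′ = b(V, U₀) ∧ RD*A′ = 0`, and (112) as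
      `T112 V U₀ A₁ := A₁ + H₁B` (the A′ of the solution).  One abstract real Hilbert-space norm stands for max{|·|_{(−1)}, |∇·|_{(−2)}} (`nMax`).
 (M2) CRITICALITY = (82): `CritL V U₀ A′ := IsCritical82 (⟨·,J⟩ + ⟨·,Δ₁A′⟩ + ⟨·,W(A′)⟩) (tangent83 Q R D*)` — the paper's own reduction (p. 290
      «by Proposition 2 it is enough …», «To find critical points … the equation (82) holds for all δA′ in the tangent space»); the
      derivative (84) of 𝔉 = (81) is `B11Eq81Expansion.hasFDerivAt84`; the gradient W(A′) = ((δ/δA′)V)(A′) is a datum `gradV`.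
 (M3) HYPOTHESIS (14) := the structural inputs at U₀ used by Sect. D (`SectDOps.Hyps`: Q* adjoint, G₁ two-sided inverse of Δ₁ + DRD* + aQ*Q,
      𝔓 the projection with 𝔓* — [5] Sect. D, Thms 3.12–3.13 —, (QG₁Q*)(QG₁Q*)⁻¹ = 1, the Landau property RD*H₁ = 0 (45)) ∧ the bound (103)
      read as ‖H₁B‖ < B₁·b at b = C₁ε₁ («2dLB₀C₁ε₁ < B₁C₁ε₁»).
 (M4) (111) LITERALLY: `Sol111 V U₀ A₁ := A₁ + G₁𝔓*J + G₁𝔓*W(A₁ + H₁B) = 0`; (104)'s «2ε₃» is the conclusion `nMax U₀ A₁ < 2ε₃` (from ‖A′‖ < 2ε₂,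
      ‖H₁B‖ < ε₂, ε₂ ≤ ¼ε₃).
 (M5) INERT FIELDS: Sect. A–C and E fields (`In18`, `Crit`, `Restricted`, `toAxial`, `In43`, `nM1`, `Def47`, `T47`, `normD`, `kerD`, `dVn`,
      `dVAnalytic`, `LikeH1B`, `Sol111G`, `SolAnalytic`) carry no claim (siblings `B11Prop3Model`, `B11Prop6Model`).
HONEST SCOPE.  The «only if» content of Prop. 5 beyond Sect. D — Proposition 2 ([6] Thm 2) and Proposition 3's change of variables — is NOT
re-proved here (reading (M1)); existence of 𝔓, G₁, (QG₁Q*)⁻¹ is hypothesis ([5]); nothing of the lattice is constructed.  Mega-formalization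
`lit-balaban`, HOME `run/shared/lean/pub/lit-balaban/`, reader/typer seat r08 gen 6 (unit `lit-balaban-r08`).  Imports `B11Eq81Expansion`,
`B11Eq108Reduction` (→ `B11Eq101Translation`), `B11`; modifies nothing.  Net new unproved facts: 0.
-/

noncomputable section

open scoped InnerProductSpace

namespace Literature.MathematicalPhysics.QuantumFieldTheory.Balaban1983to89.B11Prop5Model

open B11Eq127EulerLagrange (laplaceA)
open B11Eq129Minimizer (hOp constraint_hOp)
open B11Eq81Expansion (IsCritical82 tangent83 mem_tangent83_iff isCritical82_iff)

variable {E F : Type*} [NormedAddCommGroup E] [InnerProductSpace ℝ E] [NormedAddCommGroup F]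
  [InnerProductSpace ℝ F]
variable {S : Type*} [AddCommGroup S] [Module ℝ S]

/-! ## §1 The chain (82) ⇔ (111) -/

section Chain

variable {Δ₁ : E →L[ℝ] E} {G₁ P Padj : E →ₗ[ℝ] E} {Q : E →ₗ[ℝ] F} {Qadj : F →ₗ[ℝ] E} {Kinv : F →ₗ[ℝ] F}
variable {D : S →ₗ[ℝ] E} {R : S →ₗ[ℝ] S} {Dstar : E →ₗ[ℝ] S} {a : ℝ}

/-- **(82) ⇔ (99)–(100)** with the derivative (84) in vector form (W = the gradient ((δ/δA′)V)(A′)): A′ is critical on the tangent space (83)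
iff `⟨δA′, J⟩ + ⟨δA′, Δ₁A′⟩ + ⟨δA′, W⟩ = 0` for all δA′ with QδA′ = 0, RD*δA′ = 0. [cite: Balaban1985Variational, (82)–(84) p.290, (99)–(100) p.293] -/
theorem critical82_iff_eq99 (J W A' : E) :
    IsCritical82 (innerSL ℝ J + innerSL ℝ (Δ₁ A') + innerSL ℝ W) (tangent83 Q R Dstar) ↔
      ∀ δ : E, Q δ = 0 → R (Dstar δ) = 0 → ⟪δ, J⟫_ℝ + ⟪δ, Δ₁ A'⟫_ℝ + ⟪δ, W⟫_ℝ = 0 := by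
  rw [isCritical82_iff]
  constructor
  · intro h δ hQ hR
    have := h δ ((mem_tangent83_iff Q R Dstar δ).2 ⟨hQ, hR⟩)
    simpa [innerSL_apply_apply, real_inner_comm] using this
  · intro h δ hδ
    obtain ⟨hQ, hR⟩ := (mem_tangent83_iff Q R Dstar δ).1 hδ
    simpa [innerSL_apply_apply, real_inner_comm] using h δ hQ hR

/-- **The Sect. D chain (82) ⇔ (111), assembled.**  For A′ in the space (75)–(76) (`QA′ = b`, `RD*A′ = 0`), under the structural hypotheses of
(101)–(111) (Q* adjoint; G₁ a two-sided inverse of Δ₁ + DRD* + aQ*Q; 𝔓 the (Δ₁ + DRD* + aQ*Q)-orthogonal projection onto {QA = 0, RD*A = 0} with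
adjoint 𝔓*; (QG₁Q*)(QG₁Q*)⁻¹ = 1; RD*H₁B = 0): A′ is a critical configuration in the sense (82) — for the derivative (84) `⟨·,J⟩ + ⟨·,Δ₁A′⟩ +
⟨·,W⟩`, W = ((δ/δA′)V)(A′) — IFF `A₁ = A′ − H₁B` solves Eq. (111) `A₁ + G₁𝔓*J + G₁𝔓*W = 0`.  Links: (82) ⇔ (99) (`critical82_iff_eq99`), (99) ⇔
(101) (`B11Eq101Translation.eq101_of_eq99`/`eq99_of_eq101`), (102) (`eq102`), (101) ∧ (102) ⇔ (111) (`B11Eq108Reduction.eq111_iff_eq101`).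
[cite: Balaban1985Variational, Prop. 5 p.294, (82) p.290, (99)–(111) pp.293–294] -/
theorem critical82_iff_eq111 (hadj : ∀ (x : E) (y : F), ⟪x, Qadj y⟫_ℝ = ⟪Q x, y⟫_ℝ)
    (hΔG : ∀ x : E, laplaceA (Δ₁ : E →ₗ[ℝ] E) D R Dstar Q Qadj a (G₁ x) = x)
    (hGΔ : ∀ x : E, G₁ (laplaceA (Δ₁ : E →ₗ[ℝ] E) D R Dstar Q Qadj a x) = x)
    (hPK : ∀ x : E, Q (P x) = 0 ∧ R (Dstar (P x)) = 0) (hPid : ∀ x : E, Q x = 0 → R (Dstar x) = 0 → P x = x)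
    (hPsym : ∀ x y : E, ⟪P x, laplaceA (Δ₁ : E →ₗ[ℝ] E) D R Dstar Q Qadj a y⟫_ℝ =
      ⟪x, laplaceA (Δ₁ : E →ₗ[ℝ] E) D R Dstar Q Qadj a (P y)⟫_ℝ)
    (hPadj : ∀ x y : E, ⟪P x, y⟫_ℝ = ⟪x, Padj y⟫_ℝ) (hK : ∀ y : F, Q (G₁ (Qadj (Kinv y))) = y)
    {b : F} (hRD : R (Dstar (hOp G₁ Qadj Kinv b)) = 0) {A' : E} (hQA : Q A' = b) (hRA : R (Dstar A') = 0) (J W : E) :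
    IsCritical82 (innerSL ℝ J + innerSL ℝ (Δ₁ A') + innerSL ℝ W) (tangent83 Q R Dstar) ↔
      (A' - hOp G₁ Qadj Kinv b) + (G₁ ∘ₗ Padj) J + (G₁ ∘ₗ Padj) W = 0 := by
  set A₁ : E := A' - hOp G₁ Qadj Kinv b with hA₁
  have hA' : A' = A₁ + hOp G₁ Qadj Kinv b := by rw [hA₁, sub_add_cancel]
  -- (102): A₁ lies in the constraint space
  obtain ⟨hQ₁, hR₁⟩ := B11Eq101Translation.eq102 R Dstar hK b hRD hQA hRA
  rw [critical82_iff_eq99, B11Eq108Reduction.eq111_iff_eq101 hadj hΔG hGΔ hPK hPid hPsym hPadj J A₁ W]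
  constructor
  · -- (99) ⇒ (101), with (102)
    intro h99
    refine ⟨⟨hQ₁, hR₁⟩, ?_⟩
    have h99' : ∀ δ : E, Q δ = 0 → R (Dstar δ) = 0 →
        ⟪δ, J⟫_ℝ + ⟪δ, (Δ₁ : E →ₗ[ℝ] E) (A₁ + hOp G₁ Qadj Kinv b)⟫_ℝ + (fun x => ⟪x, W⟫_ℝ) δ = 0 := by
      intro δ hQ hR
      have := h99 δ hQ hR
      rwa [hA'] at this
    exact B11Eq101Translation.eq101_of_eq99 D R Dstar a hadj hΔG b hRD h99'
  · -- (101) ⇒ (99)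
    rintro ⟨-, h101⟩ δ hQ hR
    have h := B11Eq101Translation.eq99_of_eq101 D R Dstar a hadj hΔG b hRD (J := J) (A₁ := A₁) (DV := fun x => ⟪x, W⟫_ℝ)
      h101 δ hQ hR
    rw [hA']
    exact h

end Chain

/-! ## §2 The model family -/

/-- **The Sect. D operators at one background U₀** (dictionary of `B11Eq101Translation`/`B11Eq108Reduction`): Δ₁ (79), G₁ and the projection 𝔓
with its adjoint 𝔓* (p. 293–294; [5] Sect. D), the averaging Q = L^jηQ_j with Q* and (QG₁Q*)⁻¹ (for H₁ = G₁Q*(QG₁Q*)⁻¹, `B11Eq129Minimizer.hOp`),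
D, R, D*, the constant a, the current J of (27) and the gradient A′ ↦ ((δ/δA′)V)(A′) of the functional V (80).  Data only.
[cite: Balaban1985Variational, (79)–(84) p.290, (99)–(111) pp.293–294] -/
structure SectDOps (E F S : Type) [NormedAddCommGroup E] [InnerProductSpace ℝ E] [NormedAddCommGroup F] [InnerProductSpace ℝ F]
    [AddCommGroup S] [Module ℝ S] where
  Δ₁ : E →L[ℝ] E
  G₁ : E →ₗ[ℝ] E
  P : E →ₗ[ℝ] E
  Padj : E →ₗ[ℝ] E
  Q : E →ₗ[ℝ] F
  Qadj : F →ₗ[ℝ] E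
  Kinv : F →ₗ[ℝ] F
  D : S →ₗ[ℝ] E
  R : S →ₗ[ℝ] S
  Dstar : E →ₗ[ℝ] S
  a : ℝ
  J : E
  gradV : E → E

namespace SectDOps

variable {E F S : Type} [NormedAddCommGroup E] [InnerProductSpace ℝ E] [NormedAddCommGroup F] [InnerProductSpace ℝ F]
  [AddCommGroup S] [Module ℝ S]

/-- `Δ₁ + DRD* + aQ*Q` of the operators. [cite: Balaban1985Variational, (110) p.294] -/
abbrev M (X : SectDOps E F S) : E →ₗ[ℝ] E := laplaceA (X.Δ₁ : E →ₗ[ℝ] E) X.D X.R X.Dstar X.Q X.Qadj X.a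

/-- `H₁B = G₁Q*(QG₁Q*)⁻¹b` of the operators (`B11Eq129Minimizer.hOp`). [cite: Balaban1985Variational, (101) p.293] -/
abbrev H₁ (X : SectDOps E F S) (b : F) : E := hOp X.G₁ X.Qadj X.Kinv b

/-- **The structural inputs of Sect. D at U₀** (reading (M3)): Q* is the adjoint of Q; G₁ is a two-sided inverse of Δ₁ + DRD* + aQ*Q; 𝔓 maps into
the constraint space, is the identity there and is orthogonal for the scalar product of Δ₁ + DRD* + aQ*Q, 𝔓* is its adjoint; (QG₁Q*)(QG₁Q*)⁻¹ = 1;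
the Landau property RD*H₁ = 0 of (45).  A HYPOTHESIS structure ([5] Sect. D, Thms 3.12–3.13): nothing is asserted.
[cite: Balaban1985Variational, (45) p.285, (99)–(111) pp.293–294] -/
structure Hyps (X : SectDOps E F S) : Prop where
  adj : ∀ (x : E) (y : F), ⟪x, X.Qadj y⟫_ℝ = ⟪X.Q x, y⟫_ℝ
  MG : ∀ x : E, X.M (X.G₁ x) = x
  GM : ∀ x : E, X.G₁ (X.M x) = x
  PK : ∀ x : E, X.Q (X.P x) = 0 ∧ X.R (X.Dstar (X.P x)) = 0
  Pid : ∀ x : E, X.Q x = 0 → X.R (X.Dstar x) = 0 → X.P x = x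
  Psym : ∀ x y : E, ⟪X.P x, X.M y⟫_ℝ = ⟪x, X.M (X.P y)⟫_ℝ
  Padj_spec : ∀ x y : E, ⟪X.P x, y⟫_ℝ = ⟪x, X.Padj y⟫_ℝ
  Kinv_spec : ∀ y : F, X.Q (X.G₁ (X.Qadj (X.Kinv y))) = y
  landau : ∀ y : F, X.R (X.Dstar (X.H₁ y)) = 0

end SectDOps

/-- **A datum of the Prop. 5 model**: carriers `E` (the Sect. D variables A′, A₁ — reading (M1)), `F` (block data), `S`; backgrounds `Cfg`, boundary
data `Bdry`; the scale data `L`, `dim`; the background-dependent Sect. D operators `ops U₀` and the block datum `bdat V U₀ = b` of (20)/(75)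
(«B … uniquely determined by V» through (1.31) of [6]). [cite: Balaban1985Variational, (20) p.281, (75) p.289] -/
structure VarDatum (E F S Cfg Bdry : Type) [NormedAddCommGroup E] [InnerProductSpace ℝ E] [NormedAddCommGroup F]
    [InnerProductSpace ℝ F] [AddCommGroup S] [Module ℝ S] where
  L : ℝ
  dim : ℕ
  ops : Cfg → SectDOps E F S
  bdat : Bdry → Cfg → F

namespace VarDatum

variable {E F S Cfg Bdry : Type} [NormedAddCommGroup E] [InnerProductSpace ℝ E] [NormedAddCommGroup F] [InnerProductSpace ℝ F]
  [AddCommGroup S] [Module ℝ S]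

/-- **The `B11.LGData` carrier of a Prop. 5 datum** (readings (M1)–(M5)): `Pert := E`, `Fld := E`; `Sat14 _ c V U₀ := (ops U₀).Hyps ∧ ‖H₁B‖ < B₁·c`;
`In19_21 ε₂ V U₀ A′ := ‖A′‖ < 2ε₂ ∧ QA′ = b ∧ RD*A′ = 0`; `CritL V U₀ A′ := IsCritical82 (⟨·,J⟩ + ⟨·,Δ₁A′⟩ + ⟨·,W(A′)⟩) (tangent83 Q R D*)`; `nMax := ‖·‖`;
`Sol111 V U₀ A₁` := (111) literally with 𝔊 = G₁𝔓*; `T112 V U₀ A₁ := A₁ + H₁B`; all other fields inert (the boundary datum V enters through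
b = `bdat V U₀`, (20) «B … uniquely determined by V»).
[cite: Balaban1985Variational, (19)–(21) p.281, (82)–(83) p.290, (104) p.293, (111)–(112) p.294] -/
def toLGData (Dt : VarDatum E F S Cfg Bdry) (B₁ : ℝ) : B11.LGData where
  Cfg := Cfg
  Bdry := Bdry
  Pert := E
  GT := PUnit
  Fld := E
  Cell := PUnit
  Site := PUnit
  L := Dt.L
  eta := 1
  dim := Dt.dim
  scale := fun _ => 0
  cscale := fun _ => 0
  dist := fun _ _ => 0
  Sat14 := fun _ c V U₀ => (Dt.ops U₀).Hyps ∧ ‖(Dt.ops U₀).H₁ (Dt.bdat V U₀)‖ < B₁ * c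
  In18 := fun _ _ _ _ => True
  Crit := fun _ _ _ => True
  In19_21 := fun ε₂ V U₀ A' => ‖A'‖ < 2 * ε₂ ∧ (Dt.ops U₀).Q A' = Dt.bdat V U₀ ∧ (Dt.ops U₀).R ((Dt.ops U₀).Dstar A') = 0
  CritL := fun _ U₀ A' => IsCritical82
    (innerSL ℝ (Dt.ops U₀).J + innerSL ℝ ((Dt.ops U₀).Δ₁ A') + innerSL ℝ ((Dt.ops U₀).gradV A'))
    (tangent83 (Dt.ops U₀).Q (Dt.ops U₀).R (Dt.ops U₀).Dstar)
  Restricted := fun _ _ => True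
  toAxial := fun _ U₁ _ => U₁
  In43 := fun _ _ _ => True
  nM1 := fun _ _ => 0
  Def47 := fun _ _ => True
  T47 := fun _ A => A
  normD := fun _ _ => 0
  kerD := fun _ _ _ _ => 0
  nMax := fun _ A => ‖A‖
  dVn := fun _ _ => 0
  dVAnalytic := fun _ _ => True
  Sol111 := fun V U₀ A₁ => A₁ + ((Dt.ops U₀).G₁ ∘ₗ (Dt.ops U₀).Padj) (Dt.ops U₀).J +
    ((Dt.ops U₀).G₁ ∘ₗ (Dt.ops U₀).Padj) ((Dt.ops U₀).gradV (A₁ + (Dt.ops U₀).H₁ (Dt.bdat V U₀))) = 0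
  T112 := fun V U₀ A₁ => A₁ + (Dt.ops U₀).H₁ (Dt.bdat V U₀)
  LikeH1B := fun _ _ _ => True
  Sol111G := fun _ _ _ => True
  SolAnalytic := fun _ _ _ => True

end VarDatum

/-! ## §3 Proposition 5 for the model family -/

section Family

variable {I : Type} (Ef Ff Sf Cfgf Bdryf : I → Type) [∀ i, NormedAddCommGroup (Ef i)] [∀ i, InnerProductSpace ℝ (Ef i)]
  [∀ i, NormedAddCommGroup (Ff i)] [∀ i, InnerProductSpace ℝ (Ff i)] [∀ i, AddCommGroup (Sf i)] [∀ i, Module ℝ (Sf i)]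

/-- **Proposition 5 (p. 294) — the typed statement of record `B11.Prop5Printed B₁ B₃ C₁ fam` INHABITED BY NAME for the linearized-coordinate model
family** (readings (M1)–(M5)): for ε's with B₃ε₁ ≤ ε₀, B₁(ε₀ + C₁ε₁) ≤ ε₂, ε₂ ≤ ¼ε₃ and a background at which the Sect. D inputs and (103) hold,
every A′ in the space (19)–(21) (read: ‖A′‖ < 2ε₂, QA′ = b, RD*A′ = 0) that is a critical configuration (82) is `A₁ + H₁B` ((112)) for a solution
A₁ of Eq. (111) in the space (104) (‖A₁‖ < 2ε₃: ‖A₁‖ ≤ ‖A′‖ + ‖H₁B‖ < 2ε₂ + B₁C₁ε₁ ≤ 3ε₂ < 2ε₃).  Proof = §1 `critical82_iff_eq111` (⇒) + the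
arithmetic of (103)–(104).  Hypotheses: B₁, B₃ ≥ 0 (printed constants are positive). [cite: Balaban1985Variational, Prop. 5 (111)–(112) p.294] -/
theorem prop5Printed_model {B₁ B₃ C₁ : ℝ} (hB₁ : 0 ≤ B₁) (hB₃ : 0 ≤ B₃)
    (δ : ∀ i, VarDatum (Ef i) (Ff i) (Sf i) (Cfgf i) (Bdryf i)) :
    B11.Prop5Printed B₁ B₃ C₁ (fun i => (δ i).toLGData B₁) := by
  refine ⟨1, one_pos, ?_⟩
  intro i ε₀ ε₁ ε₂ ε₃ hε₁ h0 h1 h2 _ V U₀ h14 A' h19 hcrit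
  change Ef i at A'
  dsimp only [VarDatum.toLGData] at h14 h19 hcrit ⊢
  obtain ⟨hX, hH⟩ := h14
  obtain ⟨hA', hQA, hRA⟩ := h19
  set X := (δ i).ops U₀ with hXdef
  set b := (δ i).bdat V U₀ with hbdef
  -- (103): ‖H₁B‖ < B₁C₁ε₁ ≤ ε₂
  have hε₀ : 0 ≤ ε₀ := le_trans (mul_nonneg hB₃ hε₁.le) h0
  have hH' : ‖X.H₁ b‖ < ε₂ := by
    have : B₁ * (C₁ * ε₁) ≤ ε₂ := by nlinarith
    exact hH.trans_le this
  have hε₂ : 0 ≤ ε₂ := (norm_nonneg _).trans hH'.le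
  refine ⟨A' - X.H₁ b, ?_, ?_, sub_add_cancel _ _⟩
  · -- (104): ‖A₁‖ < 2ε₃
    calc ‖A' - X.H₁ b‖ ≤ ‖A'‖ + ‖X.H₁ b‖ := norm_sub_le _ _
      _ < 2 * ε₂ + ε₂ := add_lt_add hA' hH'
      _ ≤ 2 * ε₃ := by linarith
  · -- (111) from (82) by §1
    have h := (critical82_iff_eq111 hX.adj hX.MG hX.GM hX.PK hX.Pid hX.Psym hX.Padj_spec hX.Kinv_spec (hX.landau b)
      hQA hRA X.J (X.gradV A')).1 hcrit
    rw [sub_add_cancel]; exact h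

end Family

end Literature.MathematicalPhysics.QuantumFieldTheory.Balaban1983to89.B11Prop5Model

end
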